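import Summits.QuantumFields.YangMills.Theorems.UnitScaleTiltProp7SectET3HilbertLettersT3
import HarnessLib

/-!
# Route `UnitScaleTilt` (α), node N06(d = 3), layer 0 ∕ brick L0f — **THE REAL-COORDINATE SUMS OF THE THREE `L²` PAIRINGS**: `re ⟪u, v⟫_ℂ` on lit-balaban's weighted spaces
# `WL2 ℂ w (EuclideanSpace ℂ m)` (fine vector fields `BondL2K`, gauge parameters `SiteL2K`, block fields) IS the component sum `Σ_{i,k,s} (√w_i · c_s(u_i^k)) (√w_i · c_s(v_i^k))` over the
# √weight-scaled real and imaginary parts `c₀ = re`, `c₁ = im` — and the same sums on the ROUTE CARRIERS through ym-inputs-p01's transports `toL2`, `toL2S`, `toL2B` — i.e. the hypothesis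
# `hPX : Σ_x (e u)(x)·(e v)(x) = re ⟪u, v⟫_ℂ` of ✓ `Prop7SectET3CoordJunction` ∕ ✓ `Prop7SectET3OpsOfConjugateReading` for the design-point-(J1) coordinates, whichever carrier brick L0f picks

Cell `ym-inputs` (D-0154 (2); desk `ym-inputs-plan-1` INPUT-LIST v7 §4 row p05 = I-06 (d); p05 g1's memo `pub/ym-inputs/L0F-LOCATE-p05.md` §2 (d) «coordinates (J1): scaled by √c₀ so that
`Σ_x (e u) x·(e v) x = Re⟪toL2 u, toL2 v⟫_ℂ`»), seat ym-inputs-p05 g2.  Count-neutral helper (`--supports stmt-QuantumFields-20520 --as helper`; RULING g26-№2); registry untouched; THEOREMS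
ONLY (0 `def`, 0 `sorry`) — the coordinate EQUIVALENCE `eX` itself is brick L0f's definition (ym-inputs-p01 names it); this file proves the identity its `hPX` row needs, for the explicit
coordinate FORMULA, so that row closes by `simpa` whatever packaging the definition chooses.  NOTHING of [Balaban1985BackgroundPropagators] is asserted.

WHAT IS PROVED (ns `…Theorems.Prop7SectET3RealCoordSums`; `![z.re, z.im] s` is Mathlib's `Matrix.vecCons` — no new notation):
* §1 `re_conj_mul_eq_sum` (`re(z̄w) = Σ_s c_s(z)c_s(w)`), `re_trace_conjTranspose_mul` (`re tr(AᴴB) = Σ_{i,j,s} c_s(A_{ij}) c_s(B_{ij})`), `sqrt_mul_sqrt_mul_mul` (bookkeeping);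
* §2 ★★ `re_inner_WL2_eq_sum` — GENERIC: for any finite index `ι`, weight `w > 0`, fibre `EuclideanSpace ℂ m`: `re ⟪u, v⟫ = Σ_i Σ_k Σ_s (√(w i)·c_s(u i k))·(√(w i)·c_s(v i k))`; hence at once
  for `BondL2K ℂ 3 (periodsT3 F K) c₀ W₂`, `SiteL2K …`, `WL2 ℂ (fun _ ↦ cB) W₂` (`W₂ = EuclideanSpace ℂ (Fin 2 × Fin 2)`, constant weights);
* §3 ON THE ROUTE CARRIERS (p01's bricks L0a): ★★ `re_inner_toL2_eq_sum` (`re ⟪toL2 A, toL2 B⟫ = Σ_b Σ_i Σ_j Σ_s (√c₀·c_s(A b i j))·(√c₀·c_s(B b i j))`, from ✓`inner_toL2`),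
  ★ `re_inner_toL2B_eq_sum` (blocks, ✓`inner_toL2B`), `inner_toL2S` + ★ `re_inner_toL2S_eq_sum` (sites; the `L²` product of two gauge parameters `= c₀ Σ_x tr(λ(x)ᴴμ(x))`, not in L0a).
HONEST SCOPE: finite sums ([folklore]); no definition, no estimate; nothing of print asserted; N06(d = 3) NOT discharged; no summit∕sub-problem claim; rung R3, not Clay.

References: T. Bałaban, CMP **99** (1985) 389–434 [Balaban1985BackgroundPropagators] ((3.11) p.392, (3.16) p.393, p.391 «natural L² scalar products»); [Balaban1985Averaging] (18) p.21.
-/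

set_option autoImplicit false

noncomputable section

open scoped InnerProductSpace ComplexConjugate BigOperators

namespace Summit.QuantumFields.YangMills.Theorems.Prop7SectET3RealCoordSums

open Literature.MathematicalPhysics.QuantumFieldTheory.Balaban1983to89
open Literature.MathematicalPhysics.QuantumFieldTheory.Balaban1983to89.T3ContinuumYM3Torus
open B4Sect5Torus (TSite)
open B9SectCLatticeCarrier (Bond)
open B9Eq311L2Pairing (WL2)
open B11Eq103H1Complex (SiteL2K BondL2K)
open Summit.QuantumFields.YangMills.Theorems.Prop7SectET3Transport (periodsT3 bondEquiv siteEquiv)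
open Summit.QuantumFields.YangMills.Theorems.Prop7SectET3HilbertLetters (W₂ frobEquiv toL2 toL2S toL2B toL2_apply toL2S_apply toL2B_apply inner_frobEquiv_symm frobEquiv_symm_apply_apply
  inner_toL2 inner_toL2B)

/-! ## §1 Scalars and `2 × 2` matrices -/

/-- `re(z̄·w) = re z · re w + im z · im w = Σ_s c_s(z)·c_s(w)` with `c₀ = re`, `c₁ = im`. [folklore] -/
theorem re_conj_mul_eq_sum (z w : ℂ) : (conj z * w).re = ∑ s : Fin 2, ![z.re, z.im] s * ![w.re, w.im] s := by
  simp [Fin.sum_univ_two, Complex.mul_re, Complex.conj_re, Complex.conj_im]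

/-- `re tr(AᴴB) = Σ_{i,j} re((Ā_{ij})·B_{ij}) = Σ_i Σ_j Σ_s c_s(A_{ij})·c_s(B_{ij})` (the Frobenius ∕ Hilbert–Schmidt pairing of [Balaban1985Averaging] (18) in real coordinates).
[cite: Balaban1985Averaging, (18) p.21] -/
theorem re_trace_conjTranspose_mul {m : Type} [Fintype m] (A B : Matrix m m ℂ) :
    (Matrix.trace (A.conjTranspose * B)).re = ∑ i, ∑ j, ∑ s : Fin 2, ![(A i j).re, (A i j).im] s * ![(B i j).re, (B i j).im] s := by
  rw [Matrix.trace, Complex.re_sum, Finset.sum_comm]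
  refine Finset.sum_congr rfl fun j _ => ?_
  rw [Matrix.diag_apply, Matrix.mul_apply, Complex.re_sum]
  refine Finset.sum_congr rfl fun i _ => ?_
  rw [Matrix.conjTranspose_apply, Complex.star_def, re_conj_mul_eq_sum]

/-- `√a·x · (√a·y) = a·(x·y)` for `0 ≤ a` (the √weight scaling of the coordinates). [folklore] -/
theorem sqrt_mul_mul_sqrt_mul {a : ℝ} (ha : 0 ≤ a) (x y : ℝ) : Real.sqrt a * x * (Real.sqrt a * y) = a * (x * y) := by
  rw [mul_mul_mul_comm, Real.mul_self_sqrt ha]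

/-! ## §2 The weighted `L²` pairing over a Euclidean fibre, in real coordinates -/

/-- ★★ **`re ⟪u, v⟫ = Σ_i Σ_k Σ_s (√w_i·c_s(u_i^k))·(√w_i·c_s(v_i^k))` ON `WL2 ℂ w (EuclideanSpace ℂ m)`** — the real part of lit-balaban's weighted scalar product (3.11) is the
Euclidean component sum of the √weight-scaled real and imaginary parts; at constant weight `c₀` (`BondL2K`, `SiteL2K`) resp. `cB` (block fields) and `m = Fin 2 × Fin 2` (`W₂`) this is the
`hPX`∕`hPZ`∕`hPW` row of ✓`identities_of_conjugateReading` for the design-point-(J1) coordinates. [cite: Balaban1985BackgroundPropagators, (3.11) p.392] -/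
theorem re_inner_WL2_eq_sum {ι m : Type} [Fintype ι] [Fintype m] [DecidableEq m] {w : ι → ℝ} [Fact (∀ i, 0 < w i)]
    (u v : WL2 ℂ w (EuclideanSpace ℂ m)) :
    (⟪u, v⟫_ℂ).re = ∑ i, ∑ k, ∑ s : Fin 2,
      (Real.sqrt (w i) * ![((WL2.equiv ℂ w _ u i) k).re, ((WL2.equiv ℂ w _ u i) k).im] s) *
        (Real.sqrt (w i) * ![((WL2.equiv ℂ w _ v i) k).re, ((WL2.equiv ℂ w _ v i) k).im] s) := by
  rw [WL2.inner_def, Complex.re_sum]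
  refine Finset.sum_congr rfl fun i _ => ?_
  have hw : 0 ≤ w i := ((Fact.out : ∀ i, 0 < w i) i).le
  show ((((w i : ℝ) : ℂ)) * ⟪WL2.equiv ℂ w _ u i, WL2.equiv ℂ w _ v i⟫_ℂ).re = _
  rw [Complex.re_ofReal_mul, PiLp.inner_apply, Complex.re_sum, Finset.mul_sum]
  refine Finset.sum_congr rfl fun k _ => ?_
  simp only [sqrt_mul_mul_sqrt_mul hw, ← Finset.mul_sum]
  congr 1
  rw [← re_conj_mul_eq_sum]
  simp only [RCLike.inner_apply, mul_comm]

/-! ## §3 The same sums on the route carriers, through bricks L0a's transports -/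

variable {F : T3Family} {n K : ℕ} {c₀ cB : ℝ}

/-- ★★ **THE FINE PAIRING ON THE ROUTE CARRIER IN REAL COORDINATES**: `re ⟪toL2 A, toL2 B⟫_ℂ = Σ_b Σ_i Σ_j Σ_s (√c₀·c_s(A(b)_{ij}))·(√c₀·c_s(B(b)_{ij}))` over the route's bonds
`b : PBond (F.P K) 0` (✓`inner_toL2`: `= c₀ Σ_b tr(A(b)ᴴB(b))`). [cite: Balaban1985BackgroundPropagators, (3.11) p.392] -/
theorem re_inner_toL2_eq_sum [Fact (0 < c₀)] (A B : PBond (F.P K) 0 → Matrix (Fin 2) (Fin 2) ℂ) :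
    (⟪toL2 F K c₀ A, toL2 F K c₀ B⟫_ℂ).re = ∑ b : PBond (F.P K) 0, ∑ i : Fin 2, ∑ j : Fin 2, ∑ s : Fin 2,
      (Real.sqrt c₀ * ![(A b i j).re, (A b i j).im] s) * (Real.sqrt c₀ * ![(B b i j).re, (B b i j).im] s) := by
  have hc : 0 ≤ c₀ := (Fact.out : 0 < c₀).le
  rw [inner_toL2, Complex.re_ofReal_mul, Complex.re_sum, Finset.mul_sum]
  refine Finset.sum_congr rfl fun b _ => ?_
  rw [re_trace_conjTranspose_mul, Finset.mul_sum]
  refine Finset.sum_congr rfl fun i _ => ?_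
  rw [Finset.mul_sum]
  refine Finset.sum_congr rfl fun j _ => ?_
  rw [Finset.mul_sum]
  exact Finset.sum_congr rfl fun s _ => (sqrt_mul_mul_sqrt_mul hc _ _).symm

/-- ★ **THE BLOCK PAIRING ON THE ROUTE CARRIER IN REAL COORDINATES**: `re ⟪toL2B B, toL2B B′⟫_ℂ = Σ_c Σ_i Σ_j Σ_s (√cB·c_s(B(c)_{ij}))·(√cB·c_s(B′(c)_{ij}))` (✓`inner_toL2B`).
[cite: Balaban1985BackgroundPropagators, (3.16) p.393] -/
theorem re_inner_toL2B_eq_sum [Fact (0 < cB)] (B B' : PBond (F.P n) 0 → Matrix (Fin 2) (Fin 2) ℂ) :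
    (⟪toL2B F n cB B, toL2B F n cB B'⟫_ℂ).re = ∑ c : PBond (F.P n) 0, ∑ i : Fin 2, ∑ j : Fin 2, ∑ s : Fin 2,
      (Real.sqrt cB * ![(B c i j).re, (B c i j).im] s) * (Real.sqrt cB * ![(B' c i j).re, (B' c i j).im] s) := by
  have hc : 0 ≤ cB := (Fact.out : 0 < cB).le
  rw [inner_toL2B, Complex.re_ofReal_mul, Complex.re_sum, Finset.mul_sum]
  refine Finset.sum_congr rfl fun c _ => ?_
  rw [re_trace_conjTranspose_mul, Finset.mul_sum]
  refine Finset.sum_congr rfl fun i _ => ?_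
  rw [Finset.mul_sum]
  refine Finset.sum_congr rfl fun j _ => ?_
  rw [Finset.mul_sum]
  exact Finset.sum_congr rfl fun s _ => (sqrt_mul_mul_sqrt_mul hc _ _).symm

/-- **THE `L²` PRODUCT OF TWO GAUGE PARAMETERS ON THE ROUTE CARRIER**: `⟪toL2S λ, toL2S μ⟫_ℂ = c₀ · Σ_x tr(λ(x)ᴴ μ(x))` (sum over the route's sites; brick L0a's `inner_toL2` for sites).
[cite: Balaban1985BackgroundPropagators, p.393, (3.11) p.392] -/
theorem inner_toL2S [Fact (0 < c₀)] (l l' : Site (F.P K) 0 → Matrix (Fin 2) (Fin 2) ℂ) :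
    ⟪toL2S F K c₀ l, toL2S F K c₀ l'⟫_ℂ = (c₀ : ℂ) * ∑ x : Site (F.P K) 0, Matrix.trace ((l x).conjTranspose * l' x) := by
  rw [WL2.inner_def, ← Finset.mul_sum]
  congr 1
  rw [← (siteEquiv F K).sum_comp]
  refine Finset.sum_congr rfl fun x _ => ?_
  rw [toL2S_apply, toL2S_apply, inner_frobEquiv_symm, Equiv.symm_apply_apply]

/-- ★ **THE SITE PAIRING ON THE ROUTE CARRIER IN REAL COORDINATES**: `re ⟪toL2S λ, toL2S μ⟫_ℂ = Σ_x Σ_i Σ_j Σ_s (√c₀·c_s(λ(x)_{ij}))·(√c₀·c_s(μ(x)_{ij}))`.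
[cite: Balaban1985BackgroundPropagators, p.393, (3.11) p.392] -/
theorem re_inner_toL2S_eq_sum [Fact (0 < c₀)] (l l' : Site (F.P K) 0 → Matrix (Fin 2) (Fin 2) ℂ) :
    (⟪toL2S F K c₀ l, toL2S F K c₀ l'⟫_ℂ).re = ∑ x : Site (F.P K) 0, ∑ i : Fin 2, ∑ j : Fin 2, ∑ s : Fin 2,
      (Real.sqrt c₀ * ![(l x i j).re, (l x i j).im] s) * (Real.sqrt c₀ * ![(l' x i j).re, (l' x i j).im] s) := by
  have hc : 0 ≤ c₀ := (Fact.out : 0 < c₀).le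
  rw [inner_toL2S, Complex.re_ofReal_mul, Complex.re_sum, Finset.mul_sum]
  refine Finset.sum_congr rfl fun x _ => ?_
  rw [re_trace_conjTranspose_mul, Finset.mul_sum]
  refine Finset.sum_congr rfl fun i _ => ?_
  rw [Finset.mul_sum]
  refine Finset.sum_congr rfl fun j _ => ?_
  rw [Finset.mul_sum]
  exact Finset.sum_congr rfl fun s _ => (sqrt_mul_mul_sqrt_mul hc _ _).symm

end Summit.QuantumFields.YangMills.Theorems.Prop7SectET3RealCoordSums

end
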